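import Literature.AnabelianGeometry.EtaleTheta.EtaleThetaClass
import HarnessLib

/-!
# [EtTh] Prop. 1.3: an `EtaleThetaData` from a Kummer datum and ONE class `η̈ ∈ H¹(Π^tp_Ÿ, Δ_Θ)`,
# with HONEST-DEGENERATE `½`-coefficient groups (non-vacuity constructor; census of Prop. 1.3 / Rmk. 1.3.1)

S. Mochizuki, *The étale theta function and its Frobenioid-theoretic manifestations*, Publ. RIMS **45**
(2009), §1, Prop. 1.3 pp. 19–21, Rmk. 1.3.1 p. 21 (printed 245–247) [cite: MochizukiEtTh2009, Prop 1.3 p.20].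
Layer L2 of the abc-iut cell, seat abc-iut-L2-t6 (gen 5): file F7a of abc-iut-L2-lead (gen 3) RULINGS #13
R100 (the R78 «χ-twisted root model» cluster, E-indexed VALUE layer, hand #4). GENERIC over the frozen
interface `ThetaSetting p` / `KummerData` / `EtaleThetaData` (abc-iut-L2-t1, `EtaleThetaClass.lean`) — a
class (b) CONSTRUCTION of the frozen record, no interface clause touched, no `Prop` fact.

WHAT. The record `EtaleThetaData` (Prop. 1.3 DATA) extends `KummerData` by the class "without
denominators" `η̈^Θ ∈ H¹(Π^tp_Ÿ, Δ_Θ)` — a genuine element of the tree's real `H¹` — and by the level-`N` /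
`½Δ_Θ`-coefficient groups `H¹(Π^tp_Y, Δ_Θ ⊗ ½ℤ/Nℤ)`, `H¹(Π^tp_Y, ½Δ_Θ)`, `H¹(Π^tp_Ÿ, ½Δ_Θ)`,
`H¹(Π^tp_{Z̈_N}, …)`, which the interface carries as ABSTRACT groups with maps (the coefficient modules have
no carrier in the tree) subject to ONE law, the naturality square `resHalf_ofIntegralY`. Hence, for ANY
Kummer datum `E₀` and ANY class `η`, `KummerData.etaleThetaDataOfClass E₀ η : D.EtaleThetaData` — the
`½`-groups all := `H¹(Π^tp_Ÿ, Δ_Θ)` itself (levels constant, `toLevel`/`resHalf`/`ofIntegral := id`,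
`ofIntegralY := res_{Ÿ ≤ Y}`, the `O^×_{K/K̈}`-actions := the Kummer classes through `kumYdd`), and
`H¹(Π^tp_{Z̈_N}, …) := PUnit`. HONEST LABEL: the `½`-data are DEGENERATE (they identify "`½`-classes on `Y`"
with integral classes on `Ÿ`); this is a non-vacuity device for the E-indexed rows of the cell's census,
not a model of the coefficient modules `½Δ_Θ`.

CENSUS (kernel): `prop13_etaleThetaDataOfClass` — all four typed clauses of Prop. 1.3 (`Prop13`) HOLD at
the degenerate data (three by `rfl`, `eta_res_Ydd` with the witness `η̈` itself); `rmk131_…_iff` — Rmk. 1.3.1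
(`Rmk131`, "the denominators `½` are by no means superfluous") becomes «no unit translate `κ(a)·η̈` is a
restriction from `Π^tp_Y`», so it FAILS exactly when `η̈` extends to `Y` up to a unit class
(`not_rmk131_etaleThetaDataOfClass_of_exists`) — its printed content (the divisor `D₁` on `Ÿ` does not
descend to `Y`) is geometric and is not carried by degenerate `½`-groups. Consequence for the census:
`Nonempty D.KummerData → Nonempty D.EtaleThetaData` (`nonempty_etaleThetaData_of_nonempty_kummerData`).
Nothing of [EtTh] is asserted; typed ≠ proved; no side is taken on [IUTchIII] Cor. 3.12.
-/

noncomputable section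

namespace Literature.AnabelianGeometry.EtaleTheta

namespace ThetaSetting

variable {p : ℕ} [Fact p.Prime] {D : ThetaSetting p}

namespace KummerData

variable (E₀ : D.KummerData)

/-- The `O^×_{K/K̈}`-Kummer action on `H¹(Π^tp_Ÿ, Δ_Θ)`: `a ↦ infl(κ(a))` ("via the composite of the Kummer
map … with the natural map", Prop. 1.3 p. 20), used for every degenerate `½`-level.
[cite: MochizukiEtTh2009, Prop 1.3 p.20] -/
def kumUnitsModHom : D.unitsOKmodKdd →* D.H1 D.GtpYdd :=
  (((D.inflTheta D.GtpYdd).comp E₀.kumYdd).comp E₀.toKddHat).comp D.unitsOKmodKdd.subtype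

/-- `kumUnitsModHom` unfolded: `a ↦ infl(κ(a))`. [cite: MochizukiEtTh2009, Prop 1.3 p.20] -/
@[simp] theorem kumUnitsModHom_apply (a : D.unitsOKmodKdd) :
    E₀.kumUnitsModHom a = D.inflTheta D.GtpYdd (E₀.kumYdd (E₀.toKddHat (a : (↥D.Kdd)ˣ))) := rfl

/-- **`EtaleThetaData` from a Kummer datum and one class** `η ∈ H¹(Π^tp_Ÿ, Δ_Θ)` (playing "`η̈^Θ`", p. 21),
with HONEST-DEGENERATE `½`-coefficient groups: every `½`-group := `H¹(Π^tp_Ÿ, Δ_Θ)`, levels constant,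
`toLevel = resHalf = ofIntegral = id`, `ofIntegralY = res_{Ÿ ≤ Y}`, unit actions = Kummer classes,
`H¹(Π^tp_{Z̈_N}, …) := PUnit`. A non-vacuity device (the one law `resHalf_ofIntegralY` holds by `rfl`).
[cite: MochizukiEtTh2009, Prop 1.3 p.20] -/
def etaleThetaDataOfClass (η : D.H1 D.GtpYdd) : D.EtaleThetaData where
  toKummerData := E₀
  etaDd := η
  H1YhalfN _ := D.H1 D.GtpYdd
  etaN _ := η
  kumN _ := E₀.kumUnitsModHom
  H1Yhalf := D.H1 D.GtpYdd
  eta := η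
  toLevel _ := MonoidHom.id _
  kumHalf := E₀.kumUnitsModHom
  ofIntegralY := ContH1.res D.toTheta D.DeltaTheta D.GtpYdd_le_GtpY
  H1YddHalf := D.H1 D.GtpYdd
  resHalf := MonoidHom.id _
  ofIntegral := MonoidHom.id _
  resHalf_ofIntegralY _ := rfl
  H1ZddN _ := PUnit
  resZN _ := 1

variable (η : D.H1 D.GtpYdd)

/-- The underlying Kummer datum is the given one. [cite: MochizukiEtTh2009, Prop 1.3 p.20] -/
@[simp] theorem toKummerData_etaleThetaDataOfClass : (E₀.etaleThetaDataOfClass η).toKummerData = E₀ := rfl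

/-- `η̈^Θ` of the constructed data is the given class. [cite: MochizukiEtTh2009, Prop 1.3 p.21] -/
@[simp] theorem etaDd_etaleThetaDataOfClass : (E₀.etaleThetaDataOfClass η).etaDd = η := rfl

/-- The limit class `η^Θ` of the degenerate data is the given class. [cite: MochizukiEtTh2009, Prop 1.3 p.20] -/
@[simp] theorem eta_etaleThetaDataOfClass : (E₀.etaleThetaDataOfClass η).eta = η := rfl

/-- The `O^×_{K/K̈}`-action on the degenerate `½`-group is the Kummer action. [cite: MochizukiEtTh2009, Prop 1.3 p.20] -/
@[simp] theorem kumHalf_etaleThetaDataOfClass :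
    (E₀.etaleThetaDataOfClass η).kumHalf = E₀.kumUnitsModHom := rfl

/-- `H¹(Π^tp_Y, Δ_Θ) → H¹(Π^tp_Y, ½Δ_Θ)` of the degenerate data is restriction to `Ÿ`. [cite: MochizukiEtTh2009, Rmk 1.3.1 p.21] -/
@[simp] theorem ofIntegralY_etaleThetaDataOfClass :
    (E₀.etaleThetaDataOfClass η).ofIntegralY = ContH1.res D.toTheta D.DeltaTheta D.GtpYdd_le_GtpY := rfl

/-- `η̈` is an étale theta class of the constructed data (the unit `1`). [cite: MochizukiEtTh2009, Prop 1.3 p.21] -/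
theorem mem_thetaClasses_etaleThetaDataOfClass : η ∈ (E₀.etaleThetaDataOfClass η).thetaClasses :=
  ⟨1, one_mem _, (one_mul η).symm⟩

/-- **CENSUS, Prop. 1.3**: all four typed clauses of `Prop13` hold at the degenerate data (`toLevel_eta`,
`toLevel_kum`, `resZN_etaN` by `rfl`; `eta_res_Ydd` with witness `η̈`). Token «Prop13: WITNESSED-DEGENERATE».
[cite: MochizukiEtTh2009, Prop 1.3 p.20] -/
theorem prop13_etaleThetaDataOfClass : Prop13 (E₀.etaleThetaDataOfClass η) where
  toLevel_eta _ := rfl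
  toLevel_kum _ _ := rfl
  eta_res_Ydd := ⟨η, E₀.mem_thetaClasses_etaleThetaDataOfClass η, rfl⟩
  resZN_etaN _ := rfl

/-- **CENSUS, Rmk. 1.3.1, unfolded at the degenerate data**: `Rmk131` says that no unit translate
`infl κ(a) · η̈` (`a ∈ O^×_{K/K̈}`) is the restriction of a class on `Π^tp_Y`. [cite: MochizukiEtTh2009, Rmk 1.3.1 p.21] -/
theorem rmk131_etaleThetaDataOfClass_iff : Rmk131 (E₀.etaleThetaDataOfClass η) ↔
    ∀ (a : D.unitsOKmodKdd) (x : D.H1 D.GtpY),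
      E₀.kumUnitsModHom a * η ≠ ContH1.res D.toTheta D.DeltaTheta D.GtpYdd_le_GtpY x :=
  Iff.rfl

/-- … so Rmk. 1.3.1 FAILS at the degenerate data as soon as some unit translate of `η̈` extends to `Π^tp_Y`
(e.g. `η̈` itself, `a = 1`): its printed content ("the divisor `D₁` on `Ÿ` clearly does not descend to `Y`")
is geometric and is not carried by degenerate `½`-groups. Token «Rmk131: FAILS-AT-DEGENERATE-DATA when `η̈`
extends to `Y`». [cite: MochizukiEtTh2009, Rmk 1.3.1 p.21] -/
theorem not_rmk131_etaleThetaDataOfClass_of_exists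
    (h : ∃ (a : D.unitsOKmodKdd) (x : D.H1 D.GtpY),
      E₀.kumUnitsModHom a * η = ContH1.res D.toTheta D.DeltaTheta D.GtpYdd_le_GtpY x) :
    ¬ Rmk131 (E₀.etaleThetaDataOfClass η) := by
  obtain ⟨a, x, hx⟩ := h
  exact fun hR => hR a x hx

/-- The special case `a = 1`: if `η̈` is a restriction from `Π^tp_Y`, Rmk. 1.3.1 fails at the degenerate data.
[cite: MochizukiEtTh2009, Rmk 1.3.1 p.21] -/
theorem not_rmk131_etaleThetaDataOfClass_of_res_eq (x : D.H1 D.GtpY)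
    (hx : ContH1.res D.toTheta D.DeltaTheta D.GtpYdd_le_GtpY x = η) :
    ¬ Rmk131 (E₀.etaleThetaDataOfClass η) :=
  E₀.not_rmk131_etaleThetaDataOfClass_of_exists η ⟨1, x, by rw [map_one, one_mul, hx]⟩

end KummerData

/-- **Census consequence**: a Kummer datum alone un-vacates the `EtaleThetaData`-indexed rows — every
`E₀ : KummerData` extends (degenerately, with `η̈ := 1` or any class) to an `EtaleThetaData`.
[cite: MochizukiEtTh2009, Prop 1.3 p.20] -/
theorem nonempty_etaleThetaData_of_nonempty_kummerData (h : Nonempty D.KummerData) :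
    Nonempty D.EtaleThetaData :=
  h.map fun E₀ => E₀.etaleThetaDataOfClass 1

/-- Conversely (trivially) an `EtaleThetaData` carries a `KummerData`: the two rows of the census are
equi-inhabited. [cite: MochizukiEtTh2009, Prop 1.3 p.20] -/
theorem nonempty_etaleThetaData_iff : Nonempty D.EtaleThetaData ↔ Nonempty D.KummerData :=
  ⟨fun h => h.map EtaleThetaData.toKummerData, nonempty_etaleThetaData_of_nonempty_kummerData⟩

end ThetaSetting

end Literature.AnabelianGeometry.EtaleTheta

end
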